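import Mathlib
import HarnessLib
import HarnessLib.Audit
import Summits.QuantumFields.Statement
import Literature.MathematicalPhysics.QuantumFieldTheory.QCDTimeReflection
import HarnessLib.Audit.Status.Attr

/-!
Route: AnomalyRigidity

CLOSED (refuted) 2026-09-01T05:44:16Z by gate — reason: refuted:stmt-QuantumFields-16260 (UniformGapTreeDecay) by Summit.QuantumFields.QCD.Theorems.not_UniformGapTreeDecay — note: repair grace of 72.0 h (deadline 2026-09-01T05:42:11Z) expired without a repair — closed by the gate. The file is kept as the record of this route; refuted decls are indexed as negative knowledge (`ledger negatives`).

# Route AnomalyRigidity — the chiral point is an anomaly theorem — a uniform gap would make the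
flavour triangle analytic at zero momentum and kill the 't Hooft anomaly, so IsChiralAtZero needs no
symmetry breaking

The re-typed conjunct (2026-08-16, p117723) is `QCDOf N_f := ∃ reg, HasMassScaling ∧ IsChiralAtZero
∧ ∀ m > 0, body`; the clause
`IsChiralAtZero` (the uniform lattice gap ε fails at some positive mass, for every ε) is the
gaplessness of the chiral limit, and this
route is the mechanism for it: the deciding theorem PROVES `reg.IsChiralAtZero` from the cruxes. It
suffices to show
X = AWT ∧ GFM ∧ FMG (plus the provable-now germ lemma AGV):
AWT (AnomalousWardTriple, rank 2): ONE mass-independent AF regularisation carrying the body for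
every positive mass tuple AND an
ANOMALOUS WARD TRIPLE — local lattice observables V_μ (a conserved single-flavour vector current,
filling both vector slots), A_λ (a
non-singlet axial current), P (a pseudoscalar density) with MASS-INDEPENDENT weights u(k) whose
three-point transforms in physical momenta
converge (k → ∞, all tori beyond the scheme's) to Γ_m, Γ^P_m with: hyperoctahedral
pseudo-covariance, bi-transversality and
differentiability of Γ_m at zero momentum, and the subtracted axial Ward identity (p+q)·Γ_m = κ m
Γ^P_m + c ε(p,q) + o(|k|²) with c ≠ 0
independent of m (the non-perturbative Karsten–Smit anomaly), plus m-uniform local moment bounds,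
m-uniform truncated reflected pair
bounds, and (repair 2026-08-16T23Z) CENTRING: the one-point functions of V_μ and of P vanish on the
ray m ∈ (0,1] (lattice symmetries of
honest currents). GFM (UniformGapFarMoments, rank 3): for N_f ∈ {2,3}, asymptotic scaling, the
physical branch and centred observables
obeying those reflected bounds, a uniform lattice gap ε on (0, m₁] bounds the FAR-REGION weighted
moments of the physical ⟨V V P⟩
function uniformly in m (the L¹ form of m-uniform tree decay; robust across the periodic seam). FMG
(FarMomentsBoundGerm, rank 4):
far-region plus local moment bounds plus convergence give an m-uniformly bounded mixed germ of Γ^P_m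
at zero momentum. AGV
(AnomalyGermVanishes): covariance kills Γ_m(0,0) (R = −1), forces the linear germ to be
p₀ε(·,p)+s₀ε(·,q), transversality kills p₀,
s₀, so (p+q)·Γ_m = o(|k|²) and the bilinear form κ m B_m + c ε vanishes: |c| ≤ κ K m for all small
m, hence c = 0. Assembly:
¬IsChiralAtZero hands over exactly the uniform gap GFM needs; AGV then contradicts c ≠ 0 — the gap
hypothesis refutes itself through the
anomaly, and the rest of QCDOf is the body carried by AWT. (Superseded items kept in the file:
UniformGapTreeDecay, stmt-16260 —
misstated for the unit observable, negative lemma `uniformGapTreeDecay_false_of_gapped`, held;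
TreeDecayBoundsGerm, stmt-16261 — proved,
pointwise form, no longer on the deciding path.)
Lean: `AnomalousWardTriple ∧ UniformGapFarMoments ∧ FarMomentsBoundGerm ∧ AnomalyGermVanishes`

## Assembly
Pure logic, machine-checked sorry-free in the planner's Sketch.lean / glue.lean (`closes`, axioms
propext / Classical.choice /
Quot.sound): fix N_f ∈ {2,3}; AnomalousWardTriple gives reg, HasMassScaling, the body and the
centred triple with c ≠ 0; to prove
`reg.IsChiralAtZero` argue by contradiction: its negation is ∃ ε > 0, ∀ positive tuples,
HasLatticeMassGap ε — instantiate at the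
degenerate tuples m·1, m ∈ (0,1]; the physical-branch clause and the asymptotic scaling of β_k come
from IsQCDAlong in the body;
UniformGapFarMoments (m₁ = 1) yields the m-uniform far-region moments; FarMomentsBoundGerm yields K
and the bounded mixed germs;
AnomalyGermVanishes yields c = 0, contradicting c ≠ 0. Hence `QCDOf N_f = ⟨reg, HasMassScaling,
IsChiralAtZero, body⟩`, and
`QCD = QCDOf 2 ∧ QCDOf 3`.

Rationale: WHY THIS LINE. The chiral clause imports "massless N_f ≥ 2 QCD is gapless", whose two physics proofs
are Goldstone (needs spontaneous chiral symmetry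
breaking — no rigorous handle at weak coupling;
Literature.Barriers.QuantumFields.BanksCasherCriterion) and 't Hooft anomaly matching
(tHooft1980Naturalness; textbook form Smilga2001 Lect. 14 §14.4 (14.36)–(14.38): the flavour
triangle's anomaly pole must be
saturated by MASSLESS states — pions, or for N_f = 2 possibly massless nucleons, gapless either
way), made an amplitude theorem by
FrishmanSchwimmerBanksYankielowicz1981 and ColemanGrossman1982 (analyticity + unitarity). We
transplant the second into the
Osterwalder–Schrader/lattice setting in EUCLIDEAN GERM FORM: analyticity at zero momentum is
supplied by the very uniform-gap hypothesis
being refuted (reflection positivity + Lüscher's transfer matrix, Luscher1977,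
OsterwalderSeiler1978), covariance and transversality by
exact lattice symmetries, and the anomaly coefficient by the subtracted PCAC relation of Wilson
fermions (KarstenSmit1981,
BochicchioEtAl1985, MontvayMunster1994 §4.4.2/§5.3.2, universality FrewerRothe2001). Imported areas:
anomaly rigidity (hep-th),
invariant theory of the hyperoctahedral group, spectral theory of RP transfer matrices; what it does
that no prior route does: it is
the first mechanism for the re-typed clause, it never claims a condensate, and the mass-independence
of the weights is exactly the pin
of m_crit to the chiral point that the semantic-vacuity audit asked for.

RANKED CRUXES. #2 AnomalousWardTriple (crux; restated 2026-08-16T23Z with the centring export) — for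
N_f = 2, 3 one mass-independent AF regularisation with HasMassScaling such that (a) for every
positive mass tuple the QCDOf body holds (IsQCDAlong, non-trivial non-Gaussian glue, non-decoupled
flavour-changing pseudoscalars, one Δ(m) > 0 for T.HasMassGap and HasLatticeMassGap), and (b) there
are local lattice observables V_μ, A_λ, P (quark box 1), k-dependent MASS-INDEPENDENT weights u_V,
u_A, u_P, limits Γ_m, Γ^P_m, a constant c ≠ 0 and κ > 0 with, for every m ∈ (0,1]: convergence of
the torus transforms a_k⁸ΣΣ e^{ia_k(p·x+q·y)} u³⟨V_μ(x)V_ν(y)A_λ(0)⟩ → Γ_m and (with P, u_P) → Γ^P_m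
uniformly over tori S ≥ L_k; B₄-pseudo-covariance of Γ_m; bi-transversality of Γ_m up to o(|k|²);
differentiability of Γ_m at zero momentum; the anomalous Ward germ (p+q)·Γ_m − κmΓ^P_m −
c·det[e_μ,e_ν,p,q] = o(|k|²); plus m-uniform local weighted-moment bounds of u³⟨VVP⟩ (weights
|ξ|^i|η|^j, i,j ∈ {1,2}), m-uniform truncated reflected pair bounds ⟨ΘY ΘX·X Y⟩ − ⟨ΘY ΘX⟩⟨X Y⟩ of
the family {1, V_μ, P} at positive physical times ≥ τ inside the ball of radius 1/τ, growing at most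
like (a_k + |ξ−η|)^{−2σ}, σ < 4, and CENTRING: ⟨V_μ(x)⟩_{k,S,m} = 0 and ⟨P(x)⟩_{k,S,m} = 0 for m ∈
(0,1], eventually in k, on every torus S ≥ L_k and every site (part (b) is, clause by clause, the
body of `LeeYangMassHandover.WardTripleDataCentered reg` of crux 8892's line — definitionally equal
once the item's local abbreviation `Ev Q := ∀ᶠ k, ∀ S ≥ L_k, Q k S` is unfolded — so that line's
`stub_wardTripleAtPin` and this item share work). [difficulty: open-problem] (why it might fail:
contains the YM-grade infrared AND the light-quark regime (Δ(m) > 0 for every m, pseudo-Goldstone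
mass² ∝ m bounded below uniformly in volume); the anomaly clause needs non-perturbative control of
the subtracted PCAC insertion (power-divergent mixing) uniformly as m → 0.) [tHooft1980Naturalness,
KarstenSmit1981, BochicchioEtAl1985, FrewerRothe2001, MontvayMunster1994, JaffeWitten2000,
Smilga2001]
#3 UniformGapFarMoments (crux; replaces UniformGapTreeDecay) — for N_f ∈ {2,3}, any regularisation
whose bare coupling has two-loop asymptotic scaling, and any observables V_μ, P with weights u_V,
u_P obeying the m-uniform truncated reflected pair bounds of crux 2 and CENTRED on the ray (0, m₁]:
if the uniform lattice gap ε holds along reg.scheme (m·1) 0 0 for every m ∈ (0, m₁] and the bare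
masses are eventually on the physical branch (> −1), then the FAR-REGION weighted moments a_k⁸
ΣΣ_{x,y ∈ box S, max(|ξ|,|η|) ≥ R₀} |ξ|^i |η|^j |u³⟨V_μ(x)V_ν(y)P(0)⟩| (i, j ∈ {1,2}) are bounded by
ONE constant for all m ∈ (0,m₁], eventually in k, on every torus S ≥ L_k (ξ = a_k x, η = a_k y).
This is the L¹ form of m-uniform tree decay: it is what the germ bound consumes, and unlike the
pointwise bound with flat pair distance it is robust across the periodic seam (torus-adjacent x ≈ S
e_i, y ≈ −S e_i carry an a_k⁻³ contact enhancement that a pointwise allowance in ‖ξ−η‖ misses unless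
L_k a_k ≫ log a_k⁻¹; summed against a_k⁸ over the O(S³) seam pairs it is harmless). [deps:
AnomalousWardTriple] [difficulty: L] (why it might fail: qcdTorusExpect is the finite PERIODIC torus
functional, a (−1)^F-twisted trace, not an RP state; S-uniform, m-uniform all-direction decay from
per-pair time-direction gap bounds needs Lüscher positivity (β_k ≥ 0, from asymptotic scaling) for
the S → ∞ theory plus wrap-around control of the fermion-odd sector; the per-pair constants of
HasLatticeMassGap must be bypassed by truncated Cauchy–Schwarz on the five diagonal pairs
(TransferTruncatedSchwarzBound, p129979).) [Luscher1977, OsterwalderSeiler1978, MontvayMunster1994,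
GlimmJaffe1987]
#4 FarMomentsBoundGerm (crux; replaces TreeDecayBoundsGerm on the deciding path) — if the torus
transforms of u³⟨V_μ(x)V_ν(y)P(0)⟩ converge to Γ^P_m (m ∈ (0,m₁]) uniformly over tori S ≥ L_k, the
m-uniform local weighted-moment bounds hold at every radius, and the far-region weighted moments
beyond some R₀ are m-uniformly bounded (crux 3), then there is K such that for every m ∈ (0,m₁] and
μ, ν the mixed difference Γ^P_m(p,q) − Γ^P_m(p,0) − Γ^P_m(0,q) + Γ^P_m(0,0) equals a bilinear form
B(p,q) up to o(|(p,q)|²), with all |B_{αβ}| ≤ K (near box at radius max(R₀,1) plus far region cover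
box², so the global (1,1),(1,2),(2,1),(2,2) moments are eventually ≤ C_near + C_far; then
`treeGerm_germ_bound_of_moments` of
Theorems/HeatSlicedQuarksRobustYangMillsHandoverStubTreeDecayBoundsGermMoments.lean verbatim).
[deps: UniformGapFarMoments] [difficulty: provable-now] (why it might fail: only through a typing
slip in the near/far covering or in the simultaneous eventual bounds over all S ≥ L_k.)
[GlimmJaffe1987, OsterwalderSeiler1978]
#9 AnomalyGermVanishes (crux by kind since closes may only assume cruxes; provable-now; PROVED
p126118) — (Euclidean Coleman–Grossman germ lemma, pure analysis) for families Γ_m, Γ^P_m (m ∈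
(0,m₁]), c ∈ ℂ, κ ≥ 0, K: if for every m the tensor function Γ_m is pseudo-covariant under all
signed permutation matrices, bi-transverse up to o(|k|²), differentiable at 0, satisfies (p+q)·Γ_m −
κmΓ^P_m − c·ε(p,q) = o(|k|²), and Γ^P_m has a mixed germ B_m with |B_m| ≤ K, then c = 0.
[ColemanGrossman1982, FrishmanSchwimmerBanksYankielowicz1981]
SUPERSEDED, kept in the file: UniformGapTreeDecay (stmt-16260; misstated — the unit observables V_μ
= P = 1 meet every hypothesis while ⟨1·1·1⟩ = 1 cannot decay; negative lemma
`Theorems/UniformGapTreeDecay/Negative/UniformGapTreeDecayFalseOfGapped.lean` modulo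
`GappedUnitRegularisation`, refuter rreview 18:44Z, grounder 21:11Z, leads c5–c7 of crux 8892;
re-kinded support and HELD, decl kept because the negative lemma and
`Cruxes/RobustYangMillsHandover/Lines/lee_yang_mass_handover.lean` name it) and TreeDecayBoundsGerm
(stmt-16261; PROVED p127308 for the pointwise tree-decay hypothesis; still true, no longer on the
deciding path).

TWO-LAYER PLAN. AnomalousWardTriple ⇐ LightChiralFamily → AnomalyNonRenormalisation →
AnomalousWardTriple (the Literature definition file `QCDCurrentSector` — conserved point-split
vector currents, axial current, pseudoscalar density as `QCDLatticeObservable`s — has landed):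
LightChiralFamily = the body + convergent covariant transverse centred current sector with the Ward
germ (p+q)·Γ_m = κmΓ^P_m + c·ε for SOME c and the short-distance (asymptotic-freedom) germ of ⟨VVA⟩;
AnomalyNonRenormalisation = for every such family the short-distance germ forces c = c_free =
N_c/(4π²)·(normalisation) ≠ 0 (Adler–Bardeen on the lattice, FrewerRothe2001). UniformGapFarMoments
⇐ TransferRealisation (an RP transfer/OS realisation of the periodic torus functional along every
axis, with the (−1)^F wrap-around of the odd sector controlled S-uniformly by the gap hypothesis on
baryonic pairs) → CentredThreePointSchwarz (the landed truncated Cauchy–Schwarz bound cut by the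
hyperplane orthogonal to the axis of the largest coordinate: |⟨F·G_g⟩| ≤ √(diag 2-pt of F at gap
g)·√(truncated pair norm of G), five diagonal pairs, one threshold k₀) → UniformGapFarMoments (sum
the pointwise bound where it holds; seam pairs summed directly).

KILL CRITERIA. A proof of ¬AnomalyGermVanishes would have closed the route outright — it is proved
instead (p126118). A refutation of UniformGapFarMoments or FarMomentsBoundGerm as typed forces a
restatement of the uniformity/centring clauses of AnomalousWardTriple (misstated interface), not a
pivot — exactly what happened to UniformGapTreeDecay (unit-observable witness ⇒ centring export,
2026-08-16T23Z). A refutation of AnomalousWardTriple by exhibiting that the anomalous Ward germ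
CANNOT hold with mass-independent weights and centred honest currents (e.g. a theorem that the
subtracted PCAC insertion has no continuum limit uniformly in m) kills the lever; a proof elsewhere
that IsChiralAtZero follows from the body alone moots it.

NOT DECOMPOSED YET. The body inside AnomalousWardTriple (UV construction, Yang–Mills-grade gap, OS
packaging, E1) is deliberately NOT decomposed here: it is
the content every QCD route shares (spine nodes FullLatticeGap / LatticeToContinuum of
DiagonalSpine, GluonicCompletion of
WilsonMobilityGap), and this route's distinctive items are the chiral ones; the shared reg forces
body and sector into one existential
until the `QCDCurrentSector` vocabulary lets a structure carry the family (Two-layer plan).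
Constants (κ, c, σ = 3, the window (0,1])
are left to provers; the value of c is irrelevant to `closes`.

CHEAPEST FALSIFIER. The germ lemma AnomalyGermVanishes (pure finite-dimensional analysis) was the
cheapest falsifier and is now PROVED (p126118); hand-check before filing (R = −I ∈ B₄ has det +1 and
gives Γ(0,0) = −Γ(0,0); a rank-4 tensor pseudo-invariant
under all signed permutations has support on permutations of (0,1,2,3) with alternating values, i.e.
is a multiple of ε;
p^μ ε_{μνλρ} q^ρ ≡ 0 forces the coefficient to vanish; a bilinear form that is o(|k|²) at 0 is 0).
Second cheapest: the free-field
(β = ∞) lattice check that the VVA/VVP transforms of point-split Wilson currents with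
mass-independent weights satisfy the Ward germ
with c = N_c/(4π²)·(normalisation) — KarstenSmit1981, reproduced in MontvayMunster1994 §4.4.2
(4.261).

NUMBERS. Anomaly coefficient of the continuum ⟨A³ V^u V^u⟩ triangle: N_c × ½ × 1/(2π²) per
Smilga2001 (14.37); 't Hooft's N_f = 2 massless
nucleon solution (III50) and the N_f ≥ 3 Dynkin-index obstruction C₈ = 3 ≠ ½ (Smilga2001 (14.38)) —
both scenarios are gapless, which
is all IsChiralAtZero asks. Lüscher positivity range κ < 1/6 ⇔ m₀ > −1 (MontvayMunster1994 (4.111)),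
guaranteed eventually by
IsQCDAlong.

DEFINITION REQUESTS. `QCDCurrentSector` (topic Literature/MathematicalPhysics/QuantumFieldTheory)
has landed (conserved point-split vector current, local axial current and pseudoscalar density of
flavour f as `QCDLatticeObservable Nf 1`); still useful for the Two-layer split: the
physical-momentum torus transform of a three-point function and the truncated reflected pairing `⟨ΘY
ΘX · X Y⟩ − ⟨ΘY ΘX⟩⟨X Y⟩` as named notions, to shorten the items.

CONE FACTS (route-repair gen 1, 2026-08-16T18:28Z). The dispatcher's import-cone guardrail counted 3
unproved named facts under this route —
Literature.MathematicalPhysics.QuantumFieldTheory.ClayYangMillsEuclidean / ClayYangMillsEuclideanGap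
/ ClayYangMillsEuclideanAlong (YangMillsEuclidean.lean). None is a hypothesis of any item or of
`closes` (`#h21_route_deps`: 136 project constants, 0 unproved Literature facts; exempt
summit-grade: IsQCDAlong, OSData.HasMassGap/IsNonGaussian/IsNontrivial,
QCDRegularisation.HasMassScaling, QCDScheme.HasAsymptoticScaling/HasLatticeMassGap); all three are
`@[conjecture] [status: open]` renderings of the sibling Millennium conjunct `YangMills`, riding in
on the mandatory import chain of QCD/Statement.lean itself (QCDOS → YangMillsOS →
YangMillsEuclidean) ⇒ not debt, no needs-fact. The route's one own import, QCDTimeReflection, is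
load-bearing (siteReflect, QCDLatticeObservable.osAdjoint, fermiTheta, cfgReflect, …).
Operator-level hygiene fix suggested: move the three conjecture defs to a leaf module imported only
by YangMillsEuclideanProofs.lean.

REPAIR LOG. (gen 1, 18:28Z) cone audit, no change. (statement-revised p117723, 23:23Z, rev 4)
`QCDOf` gained the conjunct `reg.IsChiralAtZero`: nothing to add — this route was opened for the
re-typed conjunct and `closes` PROVES it from the cruxes; closes re-certified natively (conclusion
QCD, hypotheses = the cruxes, axioms propext/Classical.choice/Quot.sound). (misstated crux #3, 23Z,
rev 5) UniformGapTreeDecay superseded by UniformGapFarMoments + FarMomentsBoundGerm,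
AnomalousWardTriple restated with the centring export its consumers asked for (refuter
rreview-0816T18, grounder g62, leads c5–c7 of stmt-8892), Assembly restated, closes rewritten over
(AnomalousWardTriple, UniformGapFarMoments, FarMomentsBoundGerm, AnomalyGermVanishes) and checked
sorry-free in the planner's Sketch.lean before the edit.

Novelty: Searches (2026-08-16): `lit search --source crossref "Coleman Grossman 't Hooft consistency
condition analyticity unitarity"` (found
doi:10.1016/0550-3213(82)90028-1), `--source crossref "axial anomaly bound state spectrum confining
theories Frishman Schwimmer Banks
Yankielowicz"` (doi:10.1016/0550-3213(81)90268-6), `--source crossref "Karsten Smit lattice fermions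
species doubling triangle anomaly"`
(doi:10.1016/0550-3213(81)90549-6), `--source crossref "Reisz Rothe axial anomaly lattice
universality"` (FrewerRothe2001
doi:10.1103/physrevd.63.054506, Reisz–Rothe 1999), `--source arxiv "Kapustin Sopenko anomalous
symmetries Lieb-Schultz-Mattis"`
(arXiv:2401.02533, rigorous anomaly ⇒ gapless in 1D lattice systems — analogy only), `--source
arxiv/zbmath "anomaly matching rigorous
massless QCD gapless"` (0 hits), `--source crossref "Salmhofer Seiler proof of chiral symmetry
breaking"` (doi:10.1007/bf02352501,
strong coupling only), `lit galaxy search "anomaly matching" --star all` (24 rows: textbooks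
Smilga/Marshak/Wipf, SciPost LSM papers;
no constructive use), `lit read book:smilga2001 --grep` (Lect. 14 pp. 201–203 read), the 23 open QCD
Theses, 72 QCD cards (open +
_closed), `ledger negatives --problem QuantumFields` (4 entries, none related), barrier catalogue
(AnomalyMatching.lean is a CATALOGUE
entry killing Wigner-mode routes, used here as a resource).
Nearest prior art found: ColemanGrossman1982 / FrishmanSchwimmerBanksYankielowicz1981 (Minkowski
amplitude argument, assu  [refs: 10.1016/0550-3213(82, 10.1016/0550-3213(81, 10.1103/physrevd.63.054506, 10.1007/bf02352501, 2401.02533, doi:10.1016/0550-3213, doi:10.1103/physrevd.63.054506, doi:10.1007/bf02352501, book:smilga2001, FrewerRothe2001, ColemanGrossman1982, FrishmanSchwimmerBanksYankielowicz1981, KarstenSmit1981]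

Barriers (technique_class: anomaly-matching, analyticity-rigidity, rp-spectral): - technique_class: anomaly-matching, analyticity-rigidity, rp-spectral
- Literature.Barriers.QuantumFields.tHooftAnomalyMatching: not evaded but USED — the barrier kills
routes positing a chirally symmetric gapped (Wigner) massless limit; this route turns the same
obstruction into the proof of IsChiralAtZero and is agnostic between the Goldstone and the (N_f = 2)
massless-nucleon saturation.
- Literature.Barriers.QuantumFields.GoldstoneTheorem: consistent — at m > 0 there is no exact chiral
symmetry and a gap Δ(m) > 0 is claimed; gaplessness is claimed only as m → 0⁺; no condensate or
broken symmetry is ever asserted.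
- Literature.Barriers.QuantumFields.BanksCasherCriterion: evaded — no chiral condensate, no
near-zero Dirac mode density is needed; the anomaly replaces Σ ≠ 0.
- Literature.Barriers.QuantumFields.AokiPhaseDichotomy: not met — every limit is k → ∞ at FIXED m >
0 (bare trajectory m_crit + a_k m/Z_m, Aoki width O(a³) ≪ a_k m/Z_m); the finite-a chiral structure
of Wilson fermions is never entered.
- Literature.Barriers.QuantumFields.NielsenNinomiya: respected — Wilson fermions break chiral
symmetry explicitly; the anomaly enters through the subtracted Wilson-term insertion of the PCAC
relation (KarstenSmit1981), which is exactly what the Ward-germ clause of crux 2 asserts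
non-perturbatively.
- Literature.Barriers.QuantumFields.LinearDivergenceRenormalon: the additive mass renormalisation is
never Borel-summed; m_crit(k) is whatever makes the Ward germ read κ·m·Γ^P w

History (route lifecycle, newest last):
- 2026-08-16T23:28:58Z · rev 6: restated AnomalousWardTriple (stmt-QuantumFields-16259), Assembly (stmt-QuantumFields-16263) — repair of misstated crux #3 (refuter rreview-0816T18 18:44Z, grounder g62 21:11Z, leads c5–c7 of stmt-8892: unit observables V=P=1 satisfy every hypothesis of U (planner-rrepair-QuantumFields-AnomalyRigidity--adaaae0c-0)
- 2026-08-24T19:42:11Z · DORMANT — reconciler: no traction for 7 d (last activity item-evidence-added at 2026-08-17T18:39:01Z); parked, not closed — `ledger route dormant route-QuantumFields-Anom (operator:999:2524080)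
- 2026-08-28T21:11:33Z · REACTIVATED — reconciler: reactivated — activity statement-closed at 2026-08-28T18:46:38Z after parking at 2026-08-24T19:42:11Z (operator:999:1977555)
- 2026-08-29T05:42:11Z · BROKEN — UniformGapTreeDecay (stmt-QuantumFields-16260, support) refuted by Summit.QuantumFields.QCD.Theorems.not_UniformGapTreeDecay (prover-ym-line-fcl-p3-g20-0)
- 2026-09-01T05:44:16Z · CLOSED refuted — refuted:stmt-QuantumFields-16260 (UniformGapTreeDecay) by Summit.QuantumFields.QCD.Theorems.not_UniformGapTreeDecay (grace expired, auto-close) (gate)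

sub-problem: QCD · status: closed(refuted) · opened planner-plan-novel-QuantumFields-QCD-829546d5-v2-g5-0 2026-08-16T18:12:50Z · rev 6 · ledger route-QuantumFields-AnomalyRigidity
GENERATED by the gate from the ledger (D-0016/17). Provers cite these decls: `theorem foo : Summit.QuantumFields.QCD.Theses.AnomalyRigidity.<Decl> := …` in Summits/QuantumFields/QCD/Theorems/<Name>.lean.
-/

namespace Summit.QuantumFields.QCD.Theses.AnomalyRigidity

open scoped BigOperators Topology Manifold Classical MeasureTheory ProbabilityTheory Matrix InnerProductSpace ComplexConjugate ContinuousMap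
open Filter Set Function TopologicalSpace MeasureTheory

attribute [summit_statement] _root_.QCD

-- earlier AnomalousWardTriple (stmt-QuantumFields-16259, replaced 2026-08-16T23:28:58Z -> stmt-QuantumFields-17716): retired by None — open Literature.MathematicalPhysics.QuantumFieldTheory Literature.Probability.LatticeModels in ∀ Nf : ℕ, Nf = 2 ∨ Nf = 3 → ∃ reg : QCDRegularisation Nf, reg.HasMassScaling ∧ (∀ m : Fin Nf → ℝ, (∀ f, 0 < m f) → ∃ (z shift : QCDField Nf → ℕ → ℝ) (T : OSData (QCDField N
/-- item stmt-QuantumFields-17716 · crux · rank 2 · closed · moot by None · by planner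
why it might fail: contains the YM-grade infrared AND the light-quark regime (Δ(m) > 0 for every m, pseudo-Goldstone mass² ∝ m bounded below uniformly in volume); the anomaly clause needs non-perturbative control of the subtracted PCAC insertion (power-divergent mixing) uniformly as m → 0.
sources: tHooft1980Naturalness, KarstenSmit1981, BochicchioEtAl1985, FrewerRothe2001, MontvayMunster1994, JaffeWitten2000
[crux] for N_f = 2, 3 one mass-independent AF regularisation with HasMassScaling such that (a) for
every positive mass tuple the QCDOf body holds (IsQCDAlong, non-trivial non-Gaussian glue,
non-decoupled flavour-changing pseudoscalars, one Δ(m) > 0 for T.HasMassGap and HasLatticeMassGap),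
and (b) there are local lattice observables V_μ, A_λ, P (quark box 1), k-dependent MASS-INDEPENDENT
weights u_V, u_A, u_P, limits Γ_m, Γ^P_m, a constant c ≠ 0 and κ > 0 with, for every m ∈ (0,1]:
convergence of the torus transforms a_k⁸ΣΣ e^{ia_k(p·x+q·y)} u³⟨V_μ(x)V_ν(y)A_λ(0)⟩ → Γ_m and (with
P, u_P) → Γ^P_m uniformly over tori S ≥ L_k; B₄-pseudo-covariance of Γ_m; bi-transversality of Γ_m
up to o(|k|²); differentiability of Γ_m at zero momentum; the anomalous Ward germ (p+q)·Γ_m −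
κmΓ^P_m − c·det[e_μ,e_ν,p,q] = o(|k|²); plus m-uniform local weighted-moment bounds of u³⟨VVP⟩
(weights |ξ|^i|η|^j, i,j ∈ {1,2}), m-uniform truncated reflected pair bounds ⟨ΘY ΘX·X Y⟩ − ⟨ΘY ΘX⟩⟨X
Y⟩ of the family {1, V_μ, P} at positive physical times ≥ τ inside the ball of radius 1/τ, growing
at most like (a_k + |ξ−η|)^{−2σ}, σ < 4 (the unit observable makes the pair clause cover single
reflection norms), and — resta -/
@[route_item "route-QuantumFields-AnomalyRigidity", crux]
def AnomalousWardTriple : Prop :=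
  open Literature.MathematicalPhysics.QuantumFieldTheory Literature.Probability.LatticeModels in ∀ Nf : ℕ, Nf = 2 ∨ Nf = 3 → ∃ reg : QCDRegularisation Nf, reg.HasMassScaling ∧ (∀ m : Fin Nf → ℝ, (∀ f, 0 < m f) → ∃ z shift T, IsQCDAlong (reg.scheme m z shift) T ∧ T.IsNontrivial QCDField.glue ∧ T.IsNonGaussian QCDField.glue ∧ (∀ f g : Fin Nf, f ≠ g → T.IsNontrivial (QCDField.pseudoRe f g)) ∧ ∃ Δ > 0, T.HasMassGap Δ ∧ (reg.scheme m z shift).HasLatticeMassGap Δ) ∧ ∃ (V A : Fin 4 → QCDLatticeObservable Nf 1) (P : QCDLatticeObservable Nf 1) (uV uA uP : ℕ → ℝ) (Γ : ℝ → (Fin 4 → ℝ) → (Fin 4 → ℝ) → Fin 4 → Fin 4 → Fin 4 → ℂ) (ΓP : ℝ → (Fin 4 → ℝ) → (Fin 4 → ℝ) → Fin 4 → Fin 4 → ℂ) (c : ℂ) (κ : ℝ), let ph := fun (k : ℕ) (x : Fin 4 → ℤ) (i : Fin 4) => reg.a k * (x i : ℝ); let E := fun (k S : ℕ) (m : ℝ)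 X => qcdTorusExpect (reg.β k) (2 * S + 1) (fun fl => (reg.scheme (fun _ => m) 0 0).mq fl k) X; let C3 := fun (k S : ℕ) (m : ℝ) (X Y Z : QCDLatticeObservable Nf 1) x y => E k S m (fun U => X.onTorus (2 * S + 1) x U * Y.onTorus (2 * S + 1) y U * Z.onTorus (2 * S + 1) 0 U); let F3 := fun (k S : ℕ) (m : ℝ) X Y Z (a b d : ℕ → ℝ) (p q : Fin 4 → ℝ) => ((reg.a k ^ 8 : ℝ) : ℂ) * ∑ x ∈ box 4 S, ∑ y ∈ box 4 S, Complex.exp (Complex.I * ((∑ i : Fin 4, (p i * ph k x i + q i * ph k y i) : ℝ) : ℂ)) * ((a k * b k * d k : ℝ) : ℂ) * C3 k S m X Y Z x y; let O := fun o : Option (Fin 4 ⊕ Unit) => Option.elim o (QCDLatticeObservable.one Nf 1) (Sum.elim V fun _ => P); let w := fun o : Option (Fin 4 ⊕ Unit) => Option.elim o (fun _ => (1 : ℝ)) (Sum.elim (fun _ => uV) fun _ => uP); let R2 := fun (S : ℕ) (X Y : QCDLatticeObservable Nf 1) x y U => Y.osAdjoint.onTorus (2 * S + 1) (siteReflect y)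 U * X.osAdjoint.onTorus (2 * S + 1) (siteReflect x) U; let P2 := fun (S : ℕ) (X Y : QCDLatticeObservable Nf 1) x y U => X.onTorus (2 * S + 1) x U * Y.onTorus (2 * S + 1) y U; let V8 := (Fin 4 → ℝ) × (Fin 4 → ℝ); let q2 := fun k : V8 => ‖k‖ ^ 2; let Ev := fun (Q : ℕ → ℕ → Prop) => ∀ᶠ k in Filter.atTop, ∀ S, reg.L k ≤ S → Q k S; c ≠ 0 ∧ 0 < κ ∧ (∀ m : ℝ, 0 < m → m ≤ 1 → ((∀ p q μ ν la, ∀ δ : ℝ, 0 < δ → Ev fun k S => ‖F3 k S m (V μ) (V ν) (A la) uV uV uA p q - Γ m p q μ ν la‖ ≤ δ) ∧ (∀ p q μ ν, ∀ δ : ℝ, 0 < δ → Ev fun k S => ‖F3 k S m (V μ) (V ν) P uV uV uP p q - ΓP m p q μ ν‖ ≤ δ) ∧ (∀ R : Matrix (Fin 4) (Fin 4) ℝ, (∀ i j, R i j = 0 ∨ R i j = 1 ∨ R i j = -1) → R * R.transpose = 1 → ∀ (p q : (Fin 4 → ℝ)) μ ν la, Γ m (R.mulVec p) (R.mulVec q)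 μ ν la = ((R.det : ℝ) : ℂ) * ∑ μ', ∑ ν', ∑ la', ((R μ μ' * R ν ν' * R la la' : ℝ) : ℂ) * Γ m p q μ' ν' la') ∧ (∀ ν la, (fun k : V8 => ∑ μ : Fin 4, ((k.1 μ : ℝ) : ℂ) * Γ m k.1 k.2 μ ν la) =o[𝓝 0] q2) ∧ (∀ μ la, (fun k : V8 => ∑ ν : Fin 4, ((k.2 ν : ℝ) : ℂ) * Γ m k.1 k.2 μ ν la) =o[𝓝 0] q2) ∧ (∀ μ ν la, DifferentiableAt ℝ (fun k : V8 => Γ m k.1 k.2 μ ν la) 0) ∧ (∀ μ ν, (fun k : V8 => (∑ la : Fin 4, ((k.1 la + k.2 la : ℝ) : ℂ) * Γ m k.1 k.2 μ ν la) - ((κ * m : ℝ) : ℂ) * ΓP m k.1 k.2 μ ν - c * ((Matrix.det (Matrix.of ![Pi.single μ 1, Pi.single ν 1, k.1, k.2]) : ℝ) : ℂ)) =o[𝓝 0] q2))) ∧ (∀ Rl : ℝ, 0 < Rl → ∃ C : ℝ, ∀ m : ℝ, 0 < m → m ≤ 1 → ∀ (i j : ℕ), 1 ≤ i → i ≤ 2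 → 1 ≤ j → j ≤ 2 → ∀ μ ν : Fin 4, Ev fun k S => (∑ x ∈ box 4 S, ∑ y ∈ box 4 S, if ‖ph k x‖ ≤ Rl ∧ ‖ph k y‖ ≤ Rl then reg.a k ^ 8 * ‖ph k x‖ ^ i * ‖ph k y‖ ^ j * ‖((uV k * uV k * uP k : ℝ) : ℂ) * C3 k S m (V μ) (V ν) P x y‖ else 0) ≤ C) ∧ (∃ σ : ℝ, σ < 4 ∧ ∀ τ : ℝ, 0 < τ → ∃ C : ℝ, ∀ m : ℝ, 0 < m → m ≤ 1 → ∀ ι₁ ι₂ : Option (Fin 4 ⊕ Unit), Ev fun k S => ∀ x ∈ box 4 S, ∀ y ∈ box 4 S, τ ≤ ph k x 0 → τ ≤ ph k y 0 → ‖ph k x‖ ≤ τ⁻¹ → ‖ph k y‖ ≤ τ⁻¹ → ‖(((w ι₁ k * w ι₂ k) ^ 2 : ℝ) : ℂ) * (E k S m (fun U => R2 S (O ι₁) (O ι₂) x y U * P2 S (O ι₁) (O ι₂) x y U) - E k S m (R2 S (O ι₁) (O ι₂) x y) * E k S m (P2 S (O ι₁) (O ι₂) x y))‖ ≤ C * (reg.a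 k + ‖ph k x - ph k y‖) ^ (-(2 * σ))) ∧ (∀ m : ℝ, 0 < m → m ≤ 1 → ∀ μ : Fin 4, Ev fun k S => ∀ x ∈ box 4 S, E k S m ((V μ).onTorus (2 * S + 1) x) = 0) ∧ (∀ m : ℝ, 0 < m → m ≤ 1 → Ev fun k S => ∀ x ∈ box 4 S, E k S m (P.onTorus (2 * S + 1) x) = 0)

/-- item stmt-QuantumFields-17718 · crux · rank 3 · closed · moot by None · by planner
why it might fail: qcdTorusExpect is the finite PERIODIC torus functional, a (−1)^F-twisted trace, not an RP state: S-uniform, m-uniform all-direction decay from per-pair time-direction gap bounds needs Lüscher positivity for the S → ∞ theory plus wrap-around control of the fermion-odd sector, none in tree.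
sources: Luscher1977, OsterwalderSeiler1978, MontvayMunster1994, GlimmJaffe1987
[crux] (replaces UniformGapTreeDecay, stmt-16260, misstated for the unit observable) for N_f ∈
{2,3}, any regularisation whose bare coupling has two-loop asymptotic scaling ((reg.scheme 0 0
0).HasAsymptoticScaling, hence β_k → +∞), and any observables V_μ, P with weights u_V, u_P obeying
the m-uniform truncated reflected pair bounds of crux 2 and CENTRED on the ray (⟨V_μ(x)⟩ = ⟨P(x)⟩ =
0 for m ∈ (0,m₁], eventually in k, on every torus S ≥ L_k): if the uniform lattice gap ε holds along
reg.scheme (m·1) 0 0 for every m ∈ (0, m₁] ⊆ (0,1] and the bare masses are eventually on the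
physical branch (> −1), then there are R₀ and ONE constant C with, for all m ∈ (0,m₁], i, j ∈ {1,2},
μ, ν, eventually in k and on every torus S ≥ L_k: a_k⁸ ΣΣ_{x,y ∈ box S, max(|ξ|,|η|) ≥ R₀} |ξ|^i
|η|^j |u_V²u_P ⟨V_μ(x)V_ν(y)P(0)⟩_{k,S,m}| ≤ C (ξ = a_k x, η = a_k y) — the L¹ form of m-uniform
tree decay, which is what the germ bound consumes and, unlike a pointwise bound in the flat pair
distance, is robust across the periodic seam. [deps: AnomalousWardTriple] [difficulty: L] -/
@[route_item "route-QuantumFields-AnomalyRigidity", crux]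
def UniformGapFarMoments : Prop :=
  open Literature.MathematicalPhysics.QuantumFieldTheory Literature.Probability.LatticeModels in ∀ (Nf : ℕ) (reg : QCDRegularisation Nf) (V : Fin 4 → QCDLatticeObservable Nf 1) (P : QCDLatticeObservable Nf 1) (uV uP : ℕ → ℝ) (ε m₁ : ℝ), let ph := fun (k : ℕ) (x : Fin 4 → ℤ) (i : Fin 4) => reg.a k * (x i : ℝ); let E := fun (k S : ℕ) (m : ℝ) X => qcdTorusExpect (reg.β k) (2 * S + 1) (fun fl => (reg.scheme (fun _ : Fin Nf => m) 0 0).mq fl k) X; let C3 := fun (k S : ℕ) (m : ℝ) (X Y Z : QCDLatticeObservable Nf 1) x y => E k S m (fun U => X.onTorus (2 * S + 1) x U * Y.onTorus (2 * S + 1) y U * Z.onTorus (2 * S + 1) 0 U); let O := fun o : Option (Fin 4 ⊕ Unit) => Option.elim o (QCDLatticeObservable.one Nf 1) (Sum.elim V (fun _ : Unit => P)); let w := fun o : Option (Fin 4 ⊕ Unit) => Option.elim o (fun _ : ℕ => (1 : ℝ)) (Sum.elim (fun _ : Fin 4 => uV) (fun _ : Unit => uP)); let R2 := fun (S : ℕ)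 (X Y : QCDLatticeObservable Nf 1) x y U => Y.osAdjoint.onTorus (2 * S + 1) (siteReflect y) U * X.osAdjoint.onTorus (2 * S + 1) (siteReflect x) U; let P2 := fun (S : ℕ) (X Y : QCDLatticeObservable Nf 1) x y U => X.onTorus (2 * S + 1) x U * Y.onTorus (2 * S + 1) y U; (∃ σ : ℝ, σ < 4 ∧ ∀ τ : ℝ, 0 < τ → ∃ C : ℝ, ∀ m : ℝ, 0 < m → m ≤ 1 → ∀ ι₁ ι₂ : Option (Fin 4 ⊕ Unit), ∀ᶠ k in Filter.atTop, ∀ S : ℕ, reg.L k ≤ S → ∀ x ∈ box 4 S, ∀ y ∈ box 4 S, τ ≤ ph k x 0 → τ ≤ ph k y 0 → ‖ph k x‖ ≤ τ⁻¹ → ‖ph k y‖ ≤ τ⁻¹ → ‖(((w ι₁ k * w ι₂ k) ^ 2 : ℝ) : ℂ) * (E k S m (fun U => R2 S (O ι₁) (O ι₂) x y U * P2 S (O ι₁) (O ι₂) x y U) - E k S m (R2 S (O ι₁) (O ι₂) x y) * E k S m (P2 S (O ι₁) (O ι₂) x y))‖ ≤ C * (reg.a k + ‖ph k x - ph k y‖)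 ^ (-(2 * σ))) → 0 < ε → 0 < m₁ → m₁ ≤ 1 → (∀ m : ℝ, 0 < m → m ≤ m₁ → (reg.scheme (fun _ : Fin Nf => m) 0 0).HasLatticeMassGap ε) → (∀ m : ℝ, 0 < m → m ≤ m₁ → ∀ fl : Fin Nf, ∀ᶠ k in Filter.atTop, (-1 : ℝ) < (reg.scheme (fun _ : Fin Nf => m) 0 0).mq fl k) → Nf = 2 ∨ Nf = 3 → (reg.scheme 0 0 0).HasAsymptoticScaling → (∀ m : ℝ, 0 < m → m ≤ m₁ → ∀ μ : Fin 4, ∀ᶠ k in Filter.atTop, ∀ S : ℕ, reg.L k ≤ S → ∀ x ∈ box 4 S, E k S m ((V μ).onTorus (2 * S + 1) x) = 0) → (∀ m : ℝ, 0 < m → m ≤ m₁ → ∀ᶠ k in Filter.atTop, ∀ S : ℕ, reg.L k ≤ S → ∀ x ∈ box 4 S, E k S m (P.onTorus (2 * S + 1) x) = 0) → (∃ R₀ C : ℝ, ∀ m : ℝ, 0 < m → m ≤ m₁ → ∀ (i j : ℕ), 1 ≤ i → i ≤ 2 → 1 ≤ j → j ≤ 2 → ∀ μ ν : Fin 4,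 ∀ᶠ k in Filter.atTop, ∀ S : ℕ, reg.L k ≤ S → (∑ x ∈ box 4 S, ∑ y ∈ box 4 S, if R₀ ≤ max ‖ph k x‖ ‖ph k y‖ then reg.a k ^ 8 * ‖ph k x‖ ^ i * ‖ph k y‖ ^ j * ‖((uV k * uV k * uP k : ℝ) : ℂ) * C3 k S m (V μ) (V ν) P x y‖ else 0) ≤ C)

/-- item stmt-QuantumFields-16261 · crux · rank 4 · closed · proved by Summit.QuantumFields.QCD.Cruxes.RobustYangMillsHandover.LeeYangMassHandover.stub_treeDecayBoundsGerm @ 2d8064887cd8 (prover) · by planner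
why it might fail: the factor (a_k + d_min)^{−σ} must be summable against a_k⁸|ξ||η| uniformly in k — true for σ < 4, but the Riemann-sum comparison near the partial diagonals at lattice resolution needs care; pointwise convergence of the transforms forces a compactness step for B.
sources: GlimmJaffe1987, OsterwalderSeiler1978
[crux] if the torus transforms of u³⟨V_μ(x)V_ν(y)P(0)⟩ converge to Γ^P_m (m ∈ (0,m₁]) uniformly over
tori S ≥ L_k, the m-uniform local weighted-moment bounds hold, and the tree-decay bound of crux 3
holds, then there is K such that for every m ∈ (0,m₁] and μ, ν the mixed difference Γ^P_m(p,q) −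
Γ^P_m(p,0) − Γ^P_m(0,q) + Γ^P_m(0,0) equals a bilinear form B(p,q) up to o(|(p,q)|²), with all
|B_{αβ}| ≤ K (proof idea: the lattice transforms are trigonometric polynomials whose (1,1), (2,1),
(1,2) mixed moments are bounded uniformly in k, S, m by local integrability (weights) plus
exponential tree decay; |Φ_{k,S}(p,q) − B_{k,S}(p,q)| ≤ C(|p|²|q| + |p||q|²), B_{k,S} bounded, pass
to the limit). [deps: UniformGapTreeDecay] [difficulty: M] -/
@[route_item "route-QuantumFields-AnomalyRigidity"]
def TreeDecayBoundsGerm : Prop :=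
  open Literature.MathematicalPhysics.QuantumFieldTheory Literature.Probability.LatticeModels in ∀ (Nf : ℕ) (reg : QCDRegularisation Nf) (V : Fin 4 → QCDLatticeObservable Nf 1) (P : QCDLatticeObservable Nf 1) (uV uP : ℕ → ℝ) (ΓP : ℝ → (Fin 4 → ℝ) → (Fin 4 → ℝ) → Fin 4 → Fin 4 → ℂ) (m₁ : ℝ), let ph := fun (k : ℕ) (x : Fin 4 → ℤ) (i : Fin 4) => reg.a k * (x i : ℝ); let E := fun (k S : ℕ) (m : ℝ) X => qcdTorusExpect (reg.β k) (2 * S + 1) (fun fl => (reg.scheme (fun _ : Fin Nf => m) 0 0).mq fl k) X; let C3 := fun (k S : ℕ) (m : ℝ) (X Y Z : QCDLatticeObservable Nf 1) x y => E k S m (fun U => X.onTorus (2 * S + 1) x U * Y.onTorus (2 * S + 1) y U * Z.onTorus (2 * S + 1) 0 U); let F3 := fun (k S : ℕ) (m : ℝ) X Y Z (a b d : ℕ → ℝ) (p q : Fin 4 → ℝ) => ((reg.a k ^ 8 : ℝ) : ℂ) * ∑ x ∈ box 4 S, ∑ y ∈ box 4 S, Complex.exp (Complex.I * ((∑ i :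 Fin 4, (p i * ph k x i + q i * ph k y i) : ℝ) : ℂ)) * ((a k * b k * d k : ℝ) : ℂ) * C3 k S m X Y Z x y; let V8 := (Fin 4 → ℝ) × (Fin 4 → ℝ); let q2 := fun k : V8 => ‖k‖ ^ 2; 0 < m₁ → m₁ ≤ 1 → (∀ m : ℝ, 0 < m → m ≤ m₁ → (∀ p q μ ν, ∀ δ : ℝ, 0 < δ → ∀ᶠ k in Filter.atTop, ∀ S : ℕ, reg.L k ≤ S → ‖F3 k S m (V μ) (V ν) P uV uV uP p q - ΓP m p q μ ν‖ ≤ δ)) → (∀ Rl : ℝ, 0 < Rl → ∃ C : ℝ, ∀ m : ℝ, 0 < m → m ≤ 1 → ∀ (i j : ℕ), 1 ≤ i → i ≤ 2 → 1 ≤ j → j ≤ 2 → ∀ μ ν : Fin 4, ∀ᶠ k in Filter.atTop, ∀ S : ℕ, reg.L k ≤ S → (∑ x ∈ box 4 S, ∑ y ∈ box 4 S, if ‖ph k x‖ ≤ Rl ∧ ‖ph k y‖ ≤ Rl then reg.a k ^ 8 * ‖ph k x‖ ^ i * ‖ph k y‖ ^ j * ‖((uV k * uV k * uP k : ℝ)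 : ℂ) * C3 k S m (V μ) (V ν) P x y‖ else 0) ≤ C) → (∃ C ε' σ R₀ : ℝ, 0 < ε' ∧ σ < 4 ∧ ∀ m : ℝ, 0 < m → m ≤ m₁ → ∀ μ ν : Fin 4, ∀ᶠ k in Filter.atTop, ∀ S : ℕ, reg.L k ≤ S → ∀ x ∈ box 4 S, ∀ y ∈ box 4 S, R₀ ≤ max ‖ph k x‖ ‖ph k y‖ → ‖((uV k * uV k * uP k : ℝ) : ℂ) * C3 k S m (V μ) (V ν) P x y‖ ≤ C * Real.exp (-(ε' * max ‖ph k x‖ ‖ph k y‖)) * (1 + (reg.a k + min ‖ph k x‖ (min ‖ph k y‖ ‖ph k x - ph k y‖)) ^ (-σ))) → ∃ K : ℝ, ∀ m : ℝ, 0 < m → m ≤ m₁ → (∀ μ ν, ∃ B : Fin 4 → Fin 4 → ℂ, (∀ al be, ‖B al be‖ ≤ K) ∧ (fun k : V8 => ΓP m k.1 k.2 μ ν - ΓP m k.1 0 μ ν - ΓP m 0 k.2 μ ν + ΓP m 0 0 μ ν - ∑ al : Fin 4, ∑ be : Fin 4, B al be * ((k.1 al : ℝ) : ℂ) * ((k.2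 be : ℝ) : ℂ)) =o[nhds 0] q2)

-- `TreeDecayBoundsGerm` holds: proved by `Summit.QuantumFields.QCD.Cruxes.RobustYangMillsHandover.LeeYangMassHandover.stub_treeDecayBoundsGerm` @ 2d8064887cd8 (its module imports this route file, so no `_holds` link can be stated here).

/-- item stmt-QuantumFields-17719 · crux · rank 4 · closed · proved by Summit.QuantumFields.QCD.Cruxes.RobustYangMillsHandover.LeeYangMassHandover.stub_farMomentsBoundGerm @ 0d0b6b2247cd (prover) · by planner
why it might fail: only through a typing slip: the near box {|ξ|,|η| ≤ max R₀ 1} and the far region {R₀ ≤ max(|ξ|,|η|)} must cover box² and both eventual bounds must hold for all S ≥ L_k at once — they do; then it is treeGerm_germ_bound_of_moments (landed).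
sources: GlimmJaffe1987, OsterwalderSeiler1978
[crux] (replaces TreeDecayBoundsGerm, stmt-16261, on the deciding path; provable now) if the torus
transforms of u³⟨V_μ(x)V_ν(y)P(0)⟩ converge to Γ^P_m (m ∈ (0,m₁]) uniformly over tori S ≥ L_k, the
m-uniform LOCAL weighted-moment bounds hold at every radius, and the FAR-REGION weighted moments
beyond some R₀ are m-uniformly bounded (crux 3), then there is K such that for every m ∈ (0,m₁] and
μ, ν the mixed difference Γ^P_m(p,q) − Γ^P_m(p,0) − Γ^P_m(0,q) + Γ^P_m(0,0) equals a bilinear form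
B(p,q) up to o(|(p,q)|²) with all |B_{αβ}| ≤ K (the near box of radius max(R₀,1) and the far region
cover box², so the global (i,j)-moments, i,j ∈ {1,2}, are eventually ≤ C_near + C_far on every S ≥
L_k; then `treeGerm_germ_bound_of_moments` of
Theorems/HeatSlicedQuarksRobustYangMillsHandoverStubTreeDecayBoundsGermMoments.lean verbatim, K =
C_near + C_far). [deps: UniformGapFarMoments] [difficulty: provable-now] -/
@[route_item "route-QuantumFields-AnomalyRigidity", crux]
def FarMomentsBoundGerm : Prop :=
  open Literature.MathematicalPhysics.QuantumFieldTheory Literature.Probability.LatticeModels in ∀ (Nf : ℕ) (reg : QCDRegularisation Nf) (V : Fin 4 → QCDLatticeObservable Nf 1) (P : QCDLatticeObservable Nf 1) (uV uP : ℕ → ℝ) (ΓP : ℝ → (Fin 4 → ℝ) → (Fin 4 → ℝ) → Fin 4 → Fin 4 → ℂ) (m₁ : ℝ), let ph := fun (k : ℕ) (x : Fin 4 → ℤ) (i : Fin 4) => reg.a k * (x i : ℝ); let E := fun (k S : ℕ) (m : ℝ) X => qcdTorusExpect (reg.β k) (2 * S + 1) (fun fl => (reg.scheme (fun _ : Fin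 Nf => m) 0 0).mq fl k) X; let C3 := fun (k S : ℕ) (m : ℝ) (X Y Z : QCDLatticeObservable Nf 1) x y => E k S m (fun U => X.onTorus (2 * S + 1) x U * Y.onTorus (2 * S + 1) y U * Z.onTorus (2 * S + 1) 0 U); let F3 := fun (k S : ℕ) (m : ℝ) X Y Z (a b d : ℕ → ℝ) (p q : Fin 4 → ℝ) => ((reg.a k ^ 8 : ℝ) : ℂ) * ∑ x ∈ box 4 S, ∑ y ∈ box 4 S, Complex.exp (Complex.I * ((∑ i : Fin 4, (p i * ph k x i + q i * ph k y i) : ℝ) : ℂ)) * ((a k * b k * d k : ℝ) : ℂ) * C3 k S m X Y Z x y; let V8 := (Fin 4 → ℝ) × (Fin 4 → ℝ); let q2 := fun k : V8 => ‖k‖ ^ 2; 0 < m₁ → m₁ ≤ 1 → (∀ m : ℝ, 0 < m → m ≤ m₁ → (∀ p q μ ν, ∀ δ : ℝ, 0 < δ → ∀ᶠ k in Filter.atTop, ∀ S : ℕ, reg.L k ≤ S → ‖F3 k S m (V μ) (V ν) P uV uV uP p q - ΓP m p q μ ν‖ ≤ δ)) → (∀ Rl : ℝ, 0 < Rl → ∃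 C : ℝ, ∀ m : ℝ, 0 < m → m ≤ 1 → ∀ (i j : ℕ), 1 ≤ i → i ≤ 2 → 1 ≤ j → j ≤ 2 → ∀ μ ν : Fin 4, ∀ᶠ k in Filter.atTop, ∀ S : ℕ, reg.L k ≤ S → (∑ x ∈ box 4 S, ∑ y ∈ box 4 S, if ‖ph k x‖ ≤ Rl ∧ ‖ph k y‖ ≤ Rl then reg.a k ^ 8 * ‖ph k x‖ ^ i * ‖ph k y‖ ^ j * ‖((uV k * uV k * uP k : ℝ) : ℂ) * C3 k S m (V μ) (V ν) P x y‖ else 0) ≤ C) → (∃ R₀ C : ℝ, ∀ m : ℝ, 0 < m → m ≤ m₁ → ∀ (i j : ℕ), 1 ≤ i → i ≤ 2 → 1 ≤ j → j ≤ 2 → ∀ μ ν : Fin 4, ∀ᶠ k in Filter.atTop, ∀ S : ℕ, reg.L k ≤ S → (∑ x ∈ box 4 S, ∑ y ∈ box 4 S, if R₀ ≤ max ‖ph k x‖ ‖ph k y‖ then reg.a k ^ 8 * ‖ph k x‖ ^ i * ‖ph k y‖ ^ j * ‖((uV k * uV k * uP k : ℝ) : ℂ) * C3 k S m (V μ) (V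 ν) P x y‖ else 0) ≤ C) → ∃ K : ℝ, ∀ m : ℝ, 0 < m → m ≤ m₁ → (∀ μ ν, ∃ B : Fin 4 → Fin 4 → ℂ, (∀ al be, ‖B al be‖ ≤ K) ∧ (fun k : V8 => ΓP m k.1 k.2 μ ν - ΓP m k.1 0 μ ν - ΓP m 0 k.2 μ ν + ΓP m 0 0 μ ν - ∑ al : Fin 4, ∑ be : Fin 4, B al be * ((k.1 al : ℝ) : ℂ) * ((k.2 be : ℝ) : ℂ)) =o[nhds 0] q2)

-- `FarMomentsBoundGerm` holds: proved by `Summit.QuantumFields.QCD.Cruxes.RobustYangMillsHandover.LeeYangMassHandover.stub_farMomentsBoundGerm` @ 0d0b6b2247cd (its module imports this route file, so no `_holds` link can be stated here).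

/-- item stmt-QuantumFields-16262 · crux · rank 9 · closed · proved by Summit.QuantumFields.QCD.Cruxes.RobustYangMillsHandover.LeeYangMassHandover.stub_anomalyGermVanishes @ fdf4428a1bc4 (prover) · by planner
why it might fail: only through a typing slip: if pseudo-covariance under signed permutations did not confine the linear germ to span{ε(μνλ·)p, ε(μνλ·)q} (reflections force all four indices distinct — it does), or if o(‖k‖²) at nhds 0 of the sup-normed product were too weak to kill a bilinear form (it is not).
sources: ColemanGrossman1982, FrishmanSchwimmerBanksYankielowicz1981
[support] (Euclidean Coleman–Grossman germ lemma, pure analysis) for families Γ_m, Γ^P_m (m ∈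
(0,m₁]), c ∈ ℂ, κ ≥ 0, K: if for every m the tensor function Γ_m is pseudo-covariant under all
signed permutation matrices, bi-transverse up to o(|k|²), differentiable at 0, satisfies (p+q)·Γ_m −
κmΓ^P_m − c·ε(p,q) = o(|k|²), and Γ^P_m has a mixed germ B_m with |B_m| ≤ K, then c = 0 (R = −1
gives Γ_m(0,0) = 0; B₄-pseudo-invariant rank-4 tensors are multiples of ε, so the linear germ is
p₀ε(μνλ·)p + s₀ε(μνλ·)q and transversality forces p₀ = s₀ = 0; hence (p+q)·Γ_m = o(|k|²), the
bilinear form κmB_m + cε is o(|k|²) hence 0, |c| = κm|B_{m,23}| ≤ κKm → 0). [difficulty: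
provable-now] -/
@[route_item "route-QuantumFields-AnomalyRigidity", crux]
def AnomalyGermVanishes : Prop :=
  ∀ (Γ : ℝ → (Fin 4 → ℝ) → (Fin 4 → ℝ) → Fin 4 → Fin 4 → Fin 4 → ℂ) (ΓP : ℝ → (Fin 4 → ℝ) → (Fin 4 → ℝ) → Fin 4 → Fin 4 → ℂ) (c : ℂ) (κ K m₁ : ℝ), let V8 := (Fin 4 → ℝ) × (Fin 4 → ℝ); let q2 := fun k : V8 => ‖k‖ ^ 2; 0 < m₁ → 0 ≤ κ → (∀ m : ℝ, 0 < m → m ≤ m₁ → (∀ R : Matrix (Fin 4) (Fin 4) ℝ, (∀ i j, R i j = 0 ∨ R i j = 1 ∨ R i j = -1) → R * R.transpose = 1 → ∀ (p q : (Fin 4 → ℝ)) μ ν la, Γ m (R.mulVec p) (R.mulVec q) μ ν la = ((R.det : ℝ) : ℂ) * ∑ μ', ∑ ν', ∑ la', ((R μ μ' * R ν ν' * R la la' : ℝ) : ℂ) * Γ m p q μ' ν' la') ∧ (∀ ν la, (fun k : V8 => ∑ μ : Fin 4, ((k.1 μ : ℝ) : ℂ) * Γ m k.1 k.2 μ ν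 la) =o[nhds 0] q2) ∧ (∀ μ la, (fun k : V8 => ∑ ν : Fin 4, ((k.2 ν : ℝ) : ℂ) * Γ m k.1 k.2 μ ν la) =o[nhds 0] q2) ∧ (∀ μ ν la, DifferentiableAt ℝ (fun k : V8 => Γ m k.1 k.2 μ ν la) 0) ∧ (∀ μ ν, (fun k : V8 => (∑ la : Fin 4, ((k.1 la + k.2 la : ℝ) : ℂ) * Γ m k.1 k.2 μ ν la) - ((κ * m : ℝ) : ℂ) * ΓP m k.1 k.2 μ ν - c * ((Matrix.det (Matrix.of ![Pi.single μ 1, Pi.single ν 1, k.1, k.2]) : ℝ) : ℂ)) =o[nhds 0] q2) ∧ (∀ μ ν, ∃ B : Fin 4 → Fin 4 → ℂ, (∀ al be, ‖B al be‖ ≤ K) ∧ (fun k : V8 => ΓP m k.1 k.2 μ ν - ΓP m k.1 0 μ ν - ΓP m 0 k.2 μ ν + ΓP m 0 0 μ ν - ∑ al : Fin 4, ∑ be : Fin 4, B al be * ((k.1 al : ℝ) : ℂ) * ((k.2 be : ℝ) : ℂ)) =o[nhds 0] q2)) → c = 0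

-- `AnomalyGermVanishes` holds: proved by `Summit.QuantumFields.QCD.Cruxes.RobustYangMillsHandover.LeeYangMassHandover.stub_anomalyGermVanishes` @ fdf4428a1bc4 (its module imports this route file, so no `_holds` link can be stated here).

/-- item stmt-QuantumFields-16260 · support · rank 3 · closed · refuted by Summit.QuantumFields.QCD.Theorems.not_UniformGapTreeDecay (prover) · by planner
why it might fail: HasLatticeMassGap gives per-pair constants in the time direction on periodic tori; upgrading to norm-uniform all-direction tree decay needs Lüscher's RP transfer matrix (κ < 1/6) in infinite volume, the (−1)^F/periodic wrap-around control and hypercubic symmetry of qcdTorusExpect, none yet in tree.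
sources: Luscher1977, OsterwalderSeiler1978, MontvayMunster1994, GlimmJaffe1987
[crux] for any regularisation and any observables V_μ, P with weights u_V, u_P obeying the m-uniform
truncated reflected pair bounds of crux 2: if the uniform lattice gap ε holds along reg.scheme (m·1)
0 0 for every m ∈ (0, m₁] and the bare masses are eventually on the physical branch (> −1), then the
physical three-point function u³⟨V_μ(x)V_ν(y)P(0)⟩ obeys, for all m ∈ (0,m₁], eventually in k and on
every torus S ≥ L_k, the tree-decay bound C·exp(−ε'·max(|ξ|,|η|))·(1 + (a_k +
min(|ξ|,|η|,|ξ−η|))^{−σ}) once max(|ξ|,|η|) ≥ R₀, with C, ε' > 0, σ < 4, R₀ independent of m (ξ =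
a_k x, η = a_k y). [deps: AnomalousWardTriple] [difficulty: L] -/
@[route_item "route-QuantumFields-AnomalyRigidity"]
def UniformGapTreeDecay : Prop :=
  open Literature.MathematicalPhysics.QuantumFieldTheory Literature.Probability.LatticeModels in ∀ (Nf : ℕ) (reg : QCDRegularisation Nf) (V : Fin 4 → QCDLatticeObservable Nf 1) (P : QCDLatticeObservable Nf 1) (uV uP : ℕ → ℝ) (ε m₁ : ℝ), let ph := fun (k : ℕ) (x : Fin 4 → ℤ) (i : Fin 4) => reg.a k * (x i : ℝ); let E := fun (k S : ℕ) (m : ℝ) X => qcdTorusExpect (reg.β k) (2 * S + 1) (fun fl => (reg.scheme (fun _ : Fin Nf => m) 0 0).mq fl k) X; let C3 := fun (k S : ℕ) (m : ℝ) (X Y Z : QCDLatticeObservable Nf 1) x y => E k S m (fun U => X.onTorus (2 * S + 1) x U * Y.onTorus (2 * S + 1) y U * Z.onTorus (2 * S + 1) 0 U); let O := fun o : Option (Fin 4 ⊕ Unit) => Option.elim o (QCDLatticeObservable.one Nf 1) (Sum.elim V (fun _ : Unit => P)); let w := fun o : Option (Fin 4 ⊕ Unit) => Option.elim o (fun _ :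 ℕ => (1 : ℝ)) (Sum.elim (fun _ : Fin 4 => uV) (fun _ : Unit => uP)); let R2 := fun (S : ℕ) (X Y : QCDLatticeObservable Nf 1) x y U => Y.osAdjoint.onTorus (2 * S + 1) (siteReflect y) U * X.osAdjoint.onTorus (2 * S + 1) (siteReflect x) U; let P2 := fun (S : ℕ) (X Y : QCDLatticeObservable Nf 1) x y U => X.onTorus (2 * S + 1) x U * Y.onTorus (2 * S + 1) y U; (∃ σ : ℝ, σ < 4 ∧ ∀ τ : ℝ, 0 < τ → ∃ C : ℝ, ∀ m : ℝ, 0 < m → m ≤ 1 → ∀ ι₁ ι₂ : Option (Fin 4 ⊕ Unit), ∀ᶠ k in Filter.atTop, ∀ S : ℕ, reg.L k ≤ S → ∀ x ∈ box 4 S, ∀ y ∈ box 4 S, τ ≤ ph k x 0 → τ ≤ ph k y 0 → ‖ph k x‖ ≤ τ⁻¹ → ‖ph k y‖ ≤ τ⁻¹ → ‖(((w ι₁ k * w ι₂ k) ^ 2 : ℝ) : ℂ) * (E k S m (fun U => R2 S (O ι₁) (O ι₂) x y U * P2 S (O ι₁) (O ι₂) x y U) - E k S m (R2 S (O ι₁)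 (O ι₂) x y) * E k S m (P2 S (O ι₁) (O ι₂) x y))‖ ≤ C * (reg.a k + ‖ph k x - ph k y‖) ^ (-(2 * σ))) → 0 < ε → 0 < m₁ → m₁ ≤ 1 → (∀ m : ℝ, 0 < m → m ≤ m₁ → (reg.scheme (fun _ : Fin Nf => m) 0 0).HasLatticeMassGap ε) → (∀ m : ℝ, 0 < m → m ≤ m₁ → ∀ fl : Fin Nf, ∀ᶠ k in Filter.atTop, (-1 : ℝ) < (reg.scheme (fun _ : Fin Nf => m) 0 0).mq fl k) → (∃ C ε' σ R₀ : ℝ, 0 < ε' ∧ σ < 4 ∧ ∀ m : ℝ, 0 < m → m ≤ m₁ → ∀ μ ν : Fin 4, ∀ᶠ k in Filter.atTop, ∀ S : ℕ, reg.L k ≤ S → ∀ x ∈ box 4 S, ∀ y ∈ box 4 S, R₀ ≤ max ‖ph k x‖ ‖ph k y‖ → ‖((uV k * uV k * uP k : ℝ) : ℂ) * C3 k S m (V μ) (V ν) P x y‖ ≤ C * Real.exp (-(ε' * max ‖ph k x‖ ‖ph k y‖)) * (1 + (reg.a k + min ‖ph k x‖ (min ‖ph k y‖ ‖ph k x - ph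 k y‖)) ^ (-σ)))

-- earlier Assembly (stmt-QuantumFields-16263, replaced 2026-08-16T23:28:58Z -> stmt-QuantumFields-17717): retired by None — AnomalousWardTriple → UniformGapTreeDecay → TreeDecayBoundsGerm → AnomalyGermVanishes → QCD
/-- item stmt-QuantumFields-17717 · assembly · rank 1 · closed · proved by Summit.QuantumFields.QCD.Theorems.anomalyRigidity_assembly_proof (prover) · by planner
sources: ColemanGrossman1982, tHooft1980Naturalness
[assembly] AnomalousWardTriple → UniformGapFarMoments → FarMomentsBoundGerm → AnomalyGermVanishes →
QCD -/
@[route_item "route-QuantumFields-AnomalyRigidity"]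
def Assembly : Prop :=
  AnomalousWardTriple → UniformGapFarMoments → FarMomentsBoundGerm → AnomalyGermVanishes → QCD

-- `Assembly` holds: proved by `Summit.QuantumFields.QCD.Theorems.anomalyRigidity_assembly_proof` (its module imports this route file, so no `_holds` link can be stated here).

/-! D-0027 §2.1 — DECIDING THEOREM (planner-authored via `route open/edit --closes-file`; by planner-rrepair-QuantumFields-AnomalyRigidity--adaaae0c-0 2026-08-16T23:28:58Z) — ARCHIVED: route closed (refuted) 2026-09-01T05:44:16Z; kept so importers keep building:
its hypotheses are this route's items and its conclusion the sub-problem Statement (glue_lint), and it elaborates with this file. -/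

/-- The deciding theorem (D-0027 §2.1): the centred anomalous Ward triple, transported through the
uniform-gap ⇒ far-moment ⇒ bounded-germ chain into the germ lemma, refutes the negation of
`IsChiralAtZero`; the rest of `QCDOf` is the body carried by crux 2 (asymptotic scaling and the
physical branch, fed to crux 3, come from `IsQCDAlong` in that body). -/
@[closes "route-QuantumFields-AnomalyRigidity"] theorem closes (h2 : AnomalousWardTriple) (h3 : UniformGapFarMoments) (h4 : FarMomentsBoundGerm)
    (h9 : AnomalyGermVanishes) : QCD := by
  have main : ∀ Nf : ℕ, Nf = 2 ∨ Nf = 3 → QCDOf Nf := by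
    intro Nf hNf
    obtain ⟨reg, hms, hbody, V, A, P, uV, uA, uP, Γ, ΓP, c, κ, hc, hκ, hper, hU1, hU2, hcV, hcP⟩ :=
      h2 Nf hNf
    refine ⟨reg, hms, ?_, hbody⟩
    by_contra hchi
    apply hc
    unfold Literature.MathematicalPhysics.QuantumFieldTheory.QCDRegularisation.IsChiralAtZero at hchi
    push Not at hchi
    obtain ⟨ε, hε, hgap⟩ := hchi
    have hgap' : ∀ m : ℝ, 0 < m → m ≤ 1 →
        (reg.scheme (fun _ : Fin Nf => m) 0 0).HasLatticeMassGap ε :=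
      fun m hm _ => hgap (fun _ => m) (fun _ => hm)
    have hbranch : ∀ m : ℝ, 0 < m → m ≤ 1 → ∀ fl : Fin Nf, ∀ᶠ k in Filter.atTop,
        (-1 : ℝ) < (reg.scheme (fun _ : Fin Nf => m) 0 0).mq fl k := by
      intro m hm _ fl
      obtain ⟨z, shift, T, hT, -⟩ := hbody (fun _ => m) (fun _ => hm)
      exact hT.2.1 fl
    have hAS : (reg.scheme 0 0 0).HasAsymptoticScaling := by
      obtain ⟨z, shift, T, hT, -⟩ := hbody (fun _ => 1) (fun _ => one_pos)
      exact hT.1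
    have hfar := h3 Nf reg V P uV uP ε 1 hU2 hε one_pos le_rfl hgap' hbranch hNf hAS hcV hcP
    obtain ⟨K, hK⟩ := h4 Nf reg V P uV uP ΓP 1 one_pos le_rfl
      (fun m hm hm1 => (hper m hm hm1).2.1) hU1 hfar
    exact h9 Γ ΓP c κ K 1 one_pos hκ.le (fun m hm hm1 =>
      ⟨(hper m hm hm1).2.2.1, (hper m hm hm1).2.2.2.1, (hper m hm hm1).2.2.2.2.1,
        (hper m hm hm1).2.2.2.2.2.1, (hper m hm hm1).2.2.2.2.2.2, hK m hm hm1⟩)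
  exact ⟨main 2 (Or.inl rfl), main 3 (Or.inr rfl)⟩

end Summit.QuantumFields.QCD.Theses.AnomalyRigidity
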